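import Summits.Ventures.PercRepro.ProfilePointedCircuitClassesStarNineSplitB

/-!
# PercRepro — THE TWO-PART SPLIT OF THE DEFECT BOUND, PART C: THE ASSEMBLY, AND (★)₉ WHEN `e` IS FREE OF SMALL CIRCUITS
(p5, gen 58; `proofs/P5-GM1.md` §86)

**`defect_bound_of_tTwo_bound`**: on the simple cosimple core, `|D_e| ≤ |D_f| + |C|` follows from the FIRST-KIND BOUND
`#tTwo ≤ #cPairs + #fDep` alone — the second kind is paid by part B.  So (★)₉ on the core is exactly the first-kind
bound (census: 0 failures on all 13,364,640 instances, 265 tight).  **`card_tTwo_le_card_cPairs_of_eFree`**: when `e`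
lies in no circuit of size `≤ 4` (`e ∉ cl A` for every `3`-set `A ⊆ E − e`), the first-kind defects INJECT into the
`C`-pairs — `cpair_of_defect` gives every defect a `C`-pair inside it, and two distinct first-kind defects `τ₁, τ₂`
sharing a pair `π` would give `e ∈ cl(K₁ ∩ K₂)`, a `3`-set, by submodularity (`K_i := X − τ_i`, `ρ(K_i + e) = 4`,
`K₁ ∪ K₂ = X − π` a basis).  Hence **`inCount_le_of_eFree`**: `in_4(e) ≤ in_4(f) + thru_4({e, f})` at every such
`(e, f)` — in the dual, every plane of `N✶` with `≥ 5` points contains `e`; 10,877,424 of the 13,364,640 core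
instances (81.4 %).
-/

open scoped Matroid

namespace PercRepro.Cogirth

open Finset ThmH Skew Shadow Profile

open Classical

variable {α : Type} [DecidableEq α] {N : Matroid α} [N.Finite]

section StarNineSplitC

/-- **THE ASSEMBLY**: the first-kind bound `#tTwo ≤ #cPairs + #fDep` gives the defect bound `|D_e| ≤ |D_f| + |C|`. -/
theorem defect_bound_of_tTwo_bound (hn : (gr N).card = 9)
    (hsimple : ∀ x ∈ gr N, ∀ y ∈ gr N, x ≠ y → rk N {x, y} = 2)
    (hcos : ∀ x ∈ gr N, ∀ y ∈ gr N, x ≠ y → rk N (((gr N).erase x).erase y) = 5) {e f : α} (he : e ∈ gr N)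
    (hf : f ∈ gr N) (hef : e ≠ f) (h : (tTwo N e f).card ≤ (cPairs N e f).card + (fDep N e f).card) :
    (defTriples N e f e \ defTriples N e f f).card ≤
      (defTriples N e f f \ defTriples N e f e).card + (cPairs N e f).card := by
  rw [card_defects_eq_card_tTwo_add_card_tOneOnly, card_fdefects_eq_card_fDep_add_card_fIndep]
  have := card_tOneOnly_le_card_fIndep hn hsimple hcos he hf hef
  omega

/-- The facts of a first-kind `e`-defect: `ρ((X − τ) + e) = 4`, i.e. `e ∈ cl(X − τ)`. -/
theorem rk_insert_e_sdiff_of_tTwo (hn : (gr N).card = 9) {e f : α} (he : e ∈ gr N) (hf : f ∈ gr N) (hef : e ≠ f)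
    {τ : Finset α} (hτ : τ ∈ tTwo N e f) : rk N (insert e ((((gr N).erase e).erase f) \ τ)) = 4 := by
  unfold tTwo at hτ
  rw [mem_filter] at hτ
  obtain ⟨hτD, hne⟩ := hτ
  obtain ⟨hτX, _, _, _, hrkK, hK, _⟩ := edefect_facts hn he hf hef hτD
  have hKg : (((gr N).erase e).erase f) \ τ ⊆ gr N := sdiff_subset.trans (X_subset_gr N e f)
  have h1 := rk_insert_le_succ he hKg (N := N)
  have h2 := rk_mono' (M := N) (subset_insert e ((((gr N).erase e).erase f) \ τ))
  omega

/-- **TWO FIRST-KIND DEFECTS SHARING A `C`-PAIR PUT `e` IN THE CLOSURE OF THREE POINTS**: for `π ∈ cPairs` and distinct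
first-kind defects `τ₁, τ₂ ⊇ π`, `e ∈ cl(X − τ₁ − τ₂)` (a `3`-set). -/
theorem mem_clF_of_two_tTwo (hn : (gr N).card = 9) {e f : α} (he : e ∈ gr N) (hf : f ∈ gr N) (hef : e ≠ f)
    {π : Finset α} (hπ : π ∈ cPairs N e f) {τ₁ τ₂ : Finset α} (h₁ : τ₁ ∈ tTwo N e f) (h₂ : τ₂ ∈ tTwo N e f)
    (hπ₁ : π ⊆ τ₁) (hπ₂ : π ⊆ τ₂) (hne : τ₁ ≠ τ₂) :
    e ∈ clF N ((((gr N).erase e).erase f) \ (τ₁ ∪ τ₂)) ∧ ((((gr N).erase e).erase f) \ (τ₁ ∪ τ₂)).card = 3 := by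
  have hr₁ := rk_insert_e_sdiff_of_tTwo hn he hf hef h₁
  have hr₂ := rk_insert_e_sdiff_of_tTwo hn he hf hef h₂
  have h₁' := h₁; have h₂' := h₂
  unfold tTwo at h₁' h₂'
  rw [mem_filter] at h₁' h₂'
  obtain ⟨hτ₁X, hτ₁3, _, _, hrkK₁, hK₁, _⟩ := edefect_facts hn he hf hef h₁'.1
  obtain ⟨hτ₂X, hτ₂3, _, _, _, _, _⟩ := edefect_facts hn he hf hef h₂'.1
  -- the `C`-pair: `X − π` is a basis
  have hπ' := hπ
  unfold cPairs at hπ'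
  rw [mem_filter, mem_powersetCard] at hπ'
  obtain ⟨⟨hπX, hπ2⟩, hπbi⟩ := hπ'
  obtain ⟨_, _, _, hπcompl⟩ := mem_biIndepSets.1 hπbi
  rw [gr_sdiff_insert_ef_of_subset_X hπX, card_sdiff_of_subset hπX, card_X hn he hf hef, hπ2] at hπcompl
  have hπrk : rk N ((((gr N).erase e).erase f) \ π) = 5 := by omega
  have hX7 := card_X hn he hf hef
  set X := ((gr N).erase e).erase f with hXdef
  have hXg : X ⊆ gr N := X_subset_gr N e f
  -- `τ₁ ∩ τ₂ = π` and `X − π ⊆ K₁ ∪ K₂`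
  have hinter : τ₁ ∩ τ₂ = π := by
    apply Subset.antisymm
    · by_contra hcon
      have hlt : π ⊂ τ₁ ∩ τ₂ := Finset.ssubset_iff_subset_ne.2 ⟨subset_inter hπ₁ hπ₂, fun h => hcon (h ▸ Subset.refl _)⟩
      have hc := card_lt_card hlt
      have hle := card_le_card (inter_subset_left : τ₁ ∩ τ₂ ⊆ τ₁)
      have heq : τ₁ ∩ τ₂ = τ₁ := eq_of_subset_of_card_le inter_subset_left (by omega)
      have heq' : τ₁ ⊆ τ₂ := by rw [← heq]; exact inter_subset_right
      exact hne (eq_of_subset_of_card_le heq' (by omega))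
    · exact subset_inter hπ₁ hπ₂
  have hcover : X \ π ⊆ (X \ τ₁) ∪ (X \ τ₂) := by
    intro a ha
    rw [mem_sdiff] at ha
    rw [mem_union, mem_sdiff, mem_sdiff]
    by_cases h1 : a ∈ τ₁
    · right
      refine ⟨ha.1, fun h2 => ha.2 ?_⟩
      rw [← hinter]; exact mem_inter.2 ⟨h1, h2⟩
    · exact Or.inl ⟨ha.1, h1⟩
  -- submodularity on `K₁ + e` and `K₂ + e`
  have hI : insert e ((X \ τ₁) ∩ (X \ τ₂)) ⊆ insert e (X \ τ₁) ∩ insert e (X \ τ₂) :=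
    subset_inter (insert_subset_insert e inter_subset_left) (insert_subset_insert e inter_subset_right)
  have hs := rk_union_add_rk_le_of_subset_inter (N := N) hI
  have hu : 5 ≤ rk N (insert e (X \ τ₁) ∪ insert e (X \ τ₂)) := by
    rw [← hπrk]
    apply rk_mono'
    exact hcover.trans (union_subset_union (subset_insert e _) (subset_insert e _))
  have hIrk : rk N (insert e ((X \ τ₁) ∩ (X \ τ₂))) ≤ 3 := by omega
  have hsd : (X \ τ₁) ∩ (X \ τ₂) = X \ (τ₁ ∪ τ₂) := by
    ext a; simp only [mem_inter, mem_sdiff, mem_union, not_or]; tauto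
  rw [hsd] at hIrk
  have hcard : (X \ (τ₁ ∪ τ₂)).card = 3 := by
    have hu2 : (τ₁ ∪ τ₂).card = 4 := by
      have := card_union_add_card_inter τ₁ τ₂
      rw [hinter, hτ₁3, hτ₂3, hπ2] at this
      omega
    rw [card_sdiff_of_subset (union_subset hτ₁X hτ₂X), hX7, hu2]
  have hrk3 : rk N (X \ (τ₁ ∪ τ₂)) = 3 := by
    have := rk_eq_card_of_subset_of_rk_eq_card (M := N)
      (sdiff_subset_sdiff (Subset.refl X) subset_union_left : X \ (τ₁ ∪ τ₂) ⊆ X \ τ₁) (by rw [hrkK₁, hK₁])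
    rw [this, hcard]
  refine ⟨?_, hcard⟩
  rw [mem_clF_iff_rk_insert he (sdiff_subset.trans hXg)]
  have := rk_mono' (M := N) (subset_insert e (X \ (τ₁ ∪ τ₂)))
  omega

/-- **REGIME E — THE FIRST-KIND DEFECTS INJECT INTO THE `C`-PAIRS** when `e` lies in no circuit of size `≤ 4`
(`e ∉ cl A` for every `3`-set `A ⊆ E − e`): `#tTwo ≤ #cPairs`. -/
theorem card_tTwo_le_card_cPairs_of_eFree (hn : (gr N).card = 9)
    (hsimple : ∀ x ∈ gr N, ∀ y ∈ gr N, x ≠ y → rk N {x, y} = 2)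
    (hcos : ∀ x ∈ gr N, ∀ y ∈ gr N, x ≠ y → rk N (((gr N).erase x).erase y) = 5) {e f : α} (he : e ∈ gr N)
    (hf : f ∈ gr N) (hef : e ≠ f) (hfree : ∀ A ⊆ gr N, e ∉ A → A.card = 3 → e ∉ clF N A) :
    (tTwo N e f).card ≤ (cPairs N e f).card := by
  apply card_le_card_of_forall_subsingleton (fun (τ π : Finset α) => π ⊆ τ)
  · intro τ hτ
    have hτ' := hτ
    unfold tTwo at hτ'
    rw [mem_filter] at hτ'
    obtain ⟨hτD, _⟩ := hτ'
    obtain ⟨hτX, hτ3, _, _, _, _, hnot⟩ := edefect_facts hn he hf hef hτD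
    have hbi : insert e τ ∈ biIndepSets N 4 := by
      have := (mem_sdiff.1 hτD).1
      unfold defTriples at this
      rw [mem_filter] at this
      exact this.2
    obtain ⟨π, hπτ, hπ2, hπbi⟩ := cpair_of_defect hn hsimple hcos he hf hef hτX hτ3 hbi hnot
    refine ⟨π, ?_, hπτ⟩
    unfold cPairs
    rw [mem_filter, mem_powersetCard]
    exact ⟨⟨hπτ.trans hτX, hπ2⟩, hπbi⟩
  · intro π hπ τ₁ hτ₁ τ₂ hτ₂
    simp only [Set.mem_setOf_eq] at hτ₁ hτ₂
    by_contra hne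
    obtain ⟨hcl, hcard⟩ := mem_clF_of_two_tTwo hn he hf hef hπ hτ₁.1 hτ₂.1 hτ₁.2 hτ₂.2 hne
    exact hfree _ (sdiff_subset.trans (X_subset_gr N e f))
      (fun h => (mem_erase.1 (mem_erase.1 (mem_sdiff.1 h).1).2).1 rfl) hcard hcl

/-- **REGIME E — THE DEFECT BOUND**: `|D_e| ≤ |D_f| + |C|` when `e` lies in no circuit of size `≤ 4`. -/
theorem defect_bound_of_eFree (hn : (gr N).card = 9)
    (hsimple : ∀ x ∈ gr N, ∀ y ∈ gr N, x ≠ y → rk N {x, y} = 2)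
    (hcos : ∀ x ∈ gr N, ∀ y ∈ gr N, x ≠ y → rk N (((gr N).erase x).erase y) = 5) {e f : α} (he : e ∈ gr N)
    (hf : f ∈ gr N) (hef : e ≠ f) (hfree : ∀ A ⊆ gr N, e ∉ A → A.card = 3 → e ∉ clF N A) :
    (defTriples N e f e \ defTriples N e f f).card ≤
      (defTriples N e f f \ defTriples N e f e).card + (cPairs N e f).card := by
  apply defect_bound_of_tTwo_bound hn hsimple hcos he hf hef
  have := card_tTwo_le_card_cPairs_of_eFree hn hsimple hcos he hf hef hfree
  omega

/-- **REGIME E — (★)₉**: on a simple cosimple `N` with `#E = 9`, `in_4(e) ≤ in_4(f) + thru_4({e, f})` whenever `e`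
lies in no circuit of size `≤ 4` (dually: every plane of `N✶` with `≥ 5` points contains `e`). -/
theorem inCount_le_of_eFree (hn : (gr N).card = 9)
    (hsimple : ∀ x ∈ gr N, ∀ y ∈ gr N, x ≠ y → rk N {x, y} = 2)
    (hcos : ∀ x ∈ gr N, ∀ y ∈ gr N, x ≠ y → rk N (((gr N).erase x).erase y) = 5) {e f : α} (he : e ∈ gr N)
    (hf : f ∈ gr N) (hef : e ≠ f) (hfree : ∀ A ⊆ gr N, e ∉ A → A.card = 3 → e ∉ clF N A) :
    inCount N 4 e ≤ inCount N 4 f + thruCount N 4 {e, f} :=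
  starNine_of_defect_bound hef (defect_bound_of_eFree hn hsimple hcos he hf hef hfree)

end StarNineSplitC

end PercRepro.Cogirth
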